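import Summits.ValiantsHypothesis.ValiantsHypothesis.Cruxes.TwoProducts.RankThreeWronskian_val_idea_35_g10
import Summits.ValiantsHypothesis.ValiantsHypothesis.Theorems.TwoProducts.RankThreeAffineOLMColumnsSkip

/-!
# Crux `TwoProducts` (stmt-5906) — val-idea-35 g12, lens «REFUTE via the escape tables»: THE LAYER EMBEDDING (kernel)

REV 2.  Companion to g10 REV 8 (imported by module, nothing restated) and memo `EXPT-layer-embedding-g12.md`; filed
on VERDICT #112 (crit-8 g5) / R494, conditions (a)–(f); rev 1 = 9997f361673d72da (#114 GO); rev 2 adds ONLY §T below and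
the import of ✓ p715618 (COL-4) `Theorems/TwoProducts/RankThreeAffineOLMColumnsSkip` (director 11:44:09Z hint, #114 (ii)).
LABEL OF RECORD (#112): ★ TYPED TRANSFER / refute-lens INSTRUMENT (bookkeeping tier).  It widens the kill surface of
5906 from split rows (✓ `twoProducts_implies_affExp`, g10) to an ARBITRARY outer polynomial: `TwoProducts` forces ONE
exponent of `t` on `nv (P(w₀,w₁,w₂))` for all `P` of each degree.  NOT a cell, NOT γ, 0 distance; the kill surface
is EMPTY today — every census (g3–g11, val-neg-1) reads `t`-exponent `1`, the exponents `16r²+10` / `5^K` of the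
✓ cells are upper-bound artefacts, and no family with growing `t`-exponent is known.

KERNEL (0 sorry, axioms standard): `RankThreeUniformT`, `OLMUniformT`; `pinned_order` ((b): `RankThreeAffineLaw →
RankThreeAffineLawExp → RankThreeUniformT`, `OLMLaw → OLMUniformT` — UniformT is the WEAKEST typed rung, so
`TwoProducts → UniformT` is no progress on 3-AFF); `LayerEmbedding M` ((c): `∃` after `P, w`, mirror instance
explicit); §G `capture`; §A `prod_one_add_root_mul`, `expand_one_add`, `expand_T_add`; §W `waring_monomial4` ((d):
explicit design); §S+F `layerEmbedding_holds : LayerEmbedding Msize`, `Msize k = (3k+3)^8`, and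
UNCONDITIONALLY `rankThreeUniformT_of_twoProducts : TwoProducts → RankThreeUniformT`, `olmUniformT_of_twoProducts'`,
`not_twoProducts_of_not_rankThreeUniformT : ¬RankThreeUniformT → ¬TwoProducts`, `not_twoProducts_of_not_olmUniformT'`.
§T (rev 2, (TW-flag) currency): `olmLaw_of_twFlagPoly : TWFlagBound Q → (Q K t ≤ (K+2)^a (t+2)^a) → OLMLaw` (the residue
sentence's «in ONE line», typed against the Cruxes decl), `olmUniformT_of_twFlagPoly`, and `twoKills_of_not_olmUniformT :
¬OLMUniformT → ¬TwoProducts ∧ ∀ Q a, (Q poly) → ¬TWFlagBound Q` — `OLMUniformT` is the COMMON consequence of the crux and of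
(TW-flag, poly): ONE OLM-slot census with `t`-exponent unbounded in the degree kills BOTH by name (none is known).

HONEST STATUS.  `TwoProducts`, `RankThreeAffineLaw(Exp)`, `OLMLaw`, `RankThreeUniformT`, `OLMUniformT`: OPEN; kernel is
the IMPLICATION crux ⇒ uniform-`t` rung and its contrapositive; 0 `closes` binders move; no route/card/claim;
VP ≠ VNP is NOT proved.
-/

set_option linter.dupNamespace false

namespace Summit.ValiantsHypothesis.ValiantsHypothesis.Cruxes.TwoProducts.ValIdea35g12

section Bookkeeping

open scoped BigOperators
open MvPolynomial
open Summit.ValiantsHypothesis.ValiantsHypothesis.Theses.NewtonUnitEquations (TwoProducts)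
open Summit.ValiantsHypothesis.ValiantsHypothesis.Cruxes.TwoProducts.ValIdea35g10
  (Poly2 Poly3 nv RankThreeAffineLaw RankThreeAffineLawExp OLMLaw rankThreeAffineLawExp_of_law)

/-- Rung 3-AFF, UNIFORM-`t` form (OPEN; the WEAKEST typed rung of the side ladder): one exponent `b` of the
sparsity serves all outer degrees `k` (the constant may depend on `k`). -/
def RankThreeUniformT : Prop :=
  ∃ b : ℕ, ∀ k : ℕ, ∃ C : ℕ, ∀ (t : ℕ) (P : Poly3) (w : Fin 3 → Poly2),
    P.totalDegree ≤ k → (∀ i, (w i).support.card ≤ t) →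
    nv (MvPolynomial.aeval w P) ≤ C * (t + 2) ^ b

/-- The same on the OLM slot `w = (x, y, u)` (OPEN). -/
def OLMUniformT : Prop :=
  ∃ b : ℕ, ∀ k : ℕ, ∃ C : ℕ, ∀ (t : ℕ) (P : Poly3) (u : Poly2),
    P.totalDegree ≤ k → u.support.card ≤ t →
    nv (MvPolynomial.aeval ![X 0, X 1, u] P) ≤ C * (t + 2) ^ b

theorem uniformT_of_rankThreeAffineLaw (h : RankThreeAffineLaw) : RankThreeUniformT := by
  obtain ⟨c, hc⟩ := h
  exact ⟨c, fun k => ⟨(k + 2) ^ c, fun t P w hP hw => hc k t P w hP hw⟩⟩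

theorem uniformT_of_rankThreeAffineLawExp (h : RankThreeAffineLawExp) : RankThreeUniformT := by
  obtain ⟨a, b, hab⟩ := h
  exact ⟨b, fun k => ⟨2 ^ (a * k), fun t P w hP hw => hab k t P w hP hw⟩⟩

theorem olmCarriers_sparse (t : ℕ) (u : Poly2) (hu : u.support.card ≤ t) :
    ∀ i, ((![X 0, X 1, u] : Fin 3 → Poly2) i).support.card ≤ t + 1 := by
  intro i
  fin_cases i
  · simp [MvPolynomial.support_X]
  · simp [MvPolynomial.support_X]
  · exact hu.trans (Nat.le_succ t)

theorem pow_three_le (t b : ℕ) : (t + 1 + 2) ^ b ≤ (t + 2) ^ (2 * b) := by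
  rw [pow_mul]
  exact Nat.pow_le_pow_left (by nlinarith) b

theorem olmUniformT_of_uniformT (h : RankThreeUniformT) : OLMUniformT := by
  obtain ⟨b, hb⟩ := h
  refine ⟨2 * b, fun k => ?_⟩
  obtain ⟨C, hC⟩ := hb k
  refine ⟨C, fun t P u hP hu => ?_⟩
  have h1 := hC (t + 1) P ![X 0, X 1, u] hP (olmCarriers_sparse t u hu)
  exact h1.trans (Nat.mul_le_mul_left _ (pow_three_le t b))

theorem olmUniformT_of_olmLaw (h : OLMLaw) : OLMUniformT := by
  obtain ⟨c, hc⟩ := h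
  exact ⟨c, fun k => ⟨(k + 2) ^ c, fun t P u hP hu => hc k t P u hP hu⟩⟩

/-- (b) of VERDICT #112, pinned in kernel: `UniformT` is the WEAKEST typed rung —
`RankThreeAffineLaw → RankThreeAffineLawExp → RankThreeUniformT` and `OLMLaw → OLMUniformT`. -/
theorem pinned_order :
    (RankThreeAffineLaw → RankThreeAffineLawExp) ∧ (RankThreeAffineLawExp → RankThreeUniformT) ∧
      (OLMLaw → OLMUniformT) :=
  ⟨rankThreeAffineLawExp_of_law, uniformT_of_rankThreeAffineLawExp, olmUniformT_of_olmLaw⟩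

/-- THE LAYER EMBEDDING (proved below for `M = Msize`): for every outer `P` of degree `≤ k` and `t`-sparse
letters there are TWO genuine `TwoProducts` instances (`∃` AFTER `P, w`; the second = the mirror instance) with
`≤ M k` factors of sparsity `≤ 3t+2` whose vertex counts add up to at least `nv (P(w))`. -/
def LayerEmbedding (M : ℕ → ℕ) : Prop :=
  ∀ (k t : ℕ) (P : Poly3) (w : Fin 3 → Poly2),
    P.totalDegree ≤ k → (∀ i, (w i).support.card ≤ t) →
    ∃ (n : ℕ) (f g f' g' : Fin n → Poly2), n ≤ M k ∧
      (∀ j, (f j).support.card ≤ 3 * t + 2) ∧ (∀ j, (g j).support.card ≤ 3 * t + 2) ∧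
      (∀ j, (f' j).support.card ≤ 3 * t + 2) ∧ (∀ j, (g' j).support.card ≤ 3 * t + 2) ∧
      nv (MvPolynomial.aeval w P) ≤ nv (∏ j, f j - ∏ j, g j) + nv (∏ j, f' j - ∏ j, g' j)

theorem pow_sparsity_le (t b : ℕ) : (3 * t + 2 + 2) ^ b ≤ (t + 2) ^ (2 * b) := by
  rw [pow_mul]
  exact Nat.pow_le_pow_left (by nlinarith) b

theorem uniformT_of_twoProducts (M : ℕ → ℕ) (hE : LayerEmbedding M) (h : TwoProducts) : RankThreeUniformT := by
  obtain ⟨a, b, hab⟩ := h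
  refine ⟨2 * b, fun k => ⟨2 * 2 ^ (a * M k), fun t P w hP hw => ?_⟩⟩
  obtain ⟨n, f, g, f', g', hn, hf, hg, hf', hg', hle⟩ := hE k t P w hP hw
  have h1 : nv (∏ j, f j - ∏ j, g j) ≤ 2 ^ (a * n) * (3 * t + 2 + 2) ^ b := hab n (3 * t + 2) f g hf hg
  have h2 : nv (∏ j, f' j - ∏ j, g' j) ≤ 2 ^ (a * n) * (3 * t + 2 + 2) ^ b := hab n (3 * t + 2) f' g' hf' hg'
  have h3 : 2 ^ (a * n) ≤ 2 ^ (a * M k) := Nat.pow_le_pow_right (by norm_num) (Nat.mul_le_mul_left a hn)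
  have h4 : 2 ^ (a * n) * (3 * t + 2 + 2) ^ b ≤ 2 ^ (a * M k) * (t + 2) ^ (2 * b) :=
    Nat.mul_le_mul h3 (pow_sparsity_le t b)
  calc nv (MvPolynomial.aeval w P)
      ≤ nv (∏ j, f j - ∏ j, g j) + nv (∏ j, f' j - ∏ j, g' j) := hle
    _ ≤ 2 ^ (a * M k) * (t + 2) ^ (2 * b) + 2 ^ (a * M k) * (t + 2) ^ (2 * b) :=
        Nat.add_le_add (h1.trans h4) (h2.trans h4)
    _ = 2 * 2 ^ (a * M k) * (t + 2) ^ (2 * b) := by ring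

theorem olmUniformT_of_twoProducts (M : ℕ → ℕ) (hE : LayerEmbedding M) (h : TwoProducts) : OLMUniformT :=
  olmUniformT_of_uniformT (uniformT_of_twoProducts M hE h)

theorem not_twoProducts_of_not_uniformT (M : ℕ → ℕ) (hE : LayerEmbedding M) (hneg : ¬ RankThreeUniformT) :
    ¬ TwoProducts :=
  fun h => hneg (uniformT_of_twoProducts M hE h)

theorem not_twoProducts_of_not_olmUniformT (M : ℕ → ℕ) (hE : LayerEmbedding M) (hneg : ¬ OLMUniformT) :
    ¬ TwoProducts :=
  fun h => hneg (olmUniformT_of_twoProducts M hE h)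

end Bookkeeping

/-! ## TRANCHE G — planar layer capture -/
section Capture

abbrev Pt := Fin 2 → ℝ

def E (S : Set Pt) : Set Pt := Set.extremePoints ℝ (convexHull ℝ S)

theorem E_subset (S : Set Pt) : E S ⊆ S := extremePoints_convexHull_subset

theorem E_finite {S : Set Pt} (hS : S.Finite) : (E S).Finite := hS.subset (E_subset S)

theorem mem_E_of_strict_max (X : Set Pt) (g : Pt →ₗ[ℝ] ℝ) {p : Pt} (hp : p ∈ X)
    (hmax : ∀ q ∈ X, q ≠ p → g q < g p) : p ∈ E X := by
  classical
  have hle : ∀ q ∈ X, g q ≤ g p := fun q hq => by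
    by_cases h : q = p
    · rw [h]
    · exact (hmax q hq h).le
  have key : ∀ x ∈ convexHull ℝ X, g x ≤ g p ∧ (g x = g p → x = p) := by
    intro x hx
    rw [_root_.convexHull_eq] at hx
    obtain ⟨κ, t, w, z, hw0, hw1, hz, rfl⟩ := hx
    have hcm : t.centerMass w z = ∑ i ∈ t, w i • z i := Finset.centerMass_eq_of_sum_1 _ _ hw1
    have hg : g (t.centerMass w z) = ∑ i ∈ t, w i * g (z i) := by
      rw [hcm, map_sum]
      simp [map_smul, smul_eq_mul]
    have hsum_le : ∑ i ∈ t, w i * g (z i) ≤ ∑ i ∈ t, w i * g p :=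
      Finset.sum_le_sum fun i hi => mul_le_mul_of_nonneg_left (hle _ (hz i hi)) (hw0 i hi)
    have hsum_p : ∑ i ∈ t, w i * g p = g p := by rw [← Finset.sum_mul, hw1, one_mul]
    refine ⟨by rw [hg]; linarith, fun heq => ?_⟩
    have hzero : ∀ i ∈ t, w i ≠ 0 → z i = p := by
      intro i hi hwi
      by_contra hne
      have hlt : w i * g (z i) < w i * g p :=
        mul_lt_mul_of_pos_left (hmax _ (hz i hi) hne) (lt_of_le_of_ne (hw0 i hi) (Ne.symm hwi))
      have : ∑ j ∈ t, w j * g (z j) < ∑ j ∈ t, w j * g p :=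
        Finset.sum_lt_sum (fun j hj => mul_le_mul_of_nonneg_left (hle _ (hz j hj)) (hw0 j hj))
          ⟨i, hi, hlt⟩
      rw [hg] at heq
      linarith
    rw [← Finset.centerMass_filter_ne_zero]
    have hw1' : ∑ i ∈ t.filter (fun i => w i ≠ 0), w i = 1 := by
      rw [Finset.sum_filter_ne_zero, hw1]
    rw [Finset.centerMass_eq_of_sum_1 _ _ hw1']
    calc ∑ i ∈ t.filter (fun i => w i ≠ 0), w i • z i
        = ∑ i ∈ t.filter (fun i => w i ≠ 0), w i • p := by
          refine Finset.sum_congr rfl fun i hi => ?_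
          obtain ⟨hit, hwi⟩ := Finset.mem_filter.mp hi
          rw [hzero i hit hwi]
      _ = p := by rw [← Finset.sum_smul, hw1', one_smul]
  show p ∈ Set.extremePoints ℝ (convexHull ℝ X)
  rw [mem_extremePoints]
  refine ⟨subset_convexHull ℝ X hp, fun x₁ hx₁ x₂ hx₂ hseg => ?_⟩
  obtain ⟨a, b, ha, hb, hab, hpx⟩ := hseg
  have h1 := key x₁ hx₁
  have h2 := key x₂ hx₂
  have hgp : g p = a * g x₁ + b * g x₂ := by
    rw [← hpx, map_add, map_smul, map_smul, smul_eq_mul, smul_eq_mul]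
  have t1 : 0 ≤ a * (g p - g x₁) := mul_nonneg ha.le (by linarith [h1.1])
  have t2 : 0 ≤ b * (g p - g x₂) := mul_nonneg hb.le (by linarith [h2.1])
  have hsum : a * (g p - g x₁) + b * (g p - g x₂) = 0 := by
    linear_combination (g p) * hab + hgp
  have z1 : a * (g p - g x₁) = 0 := by linarith
  have z2 : b * (g p - g x₂) = 0 := by linarith
  have e1 : g x₁ = g p := by
    have := (mul_eq_zero.1 z1).resolve_left ha.ne'
    linarith
  have e2 : g x₂ = g p := by
    have := (mul_eq_zero.1 z2).resolve_left hb.ne'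
    linarith
  exact ⟨h1.2 e1, h2.2 e2⟩

def fnl (α β : ℝ) : Pt →ₗ[ℝ] ℝ where
  toFun p := α * p 0 + β * p 1
  map_add' p q := by simp only [Pi.add_apply]; ring
  map_smul' c p := by simp only [Pi.smul_apply, smul_eq_mul, RingHom.id_apply]; ring

theorem fnl_apply (α β : ℝ) (p : Pt) : fnl α β p = α * p 0 + β * p 1 := rfl

theorem mem_E_of_strict (X : Set Pt) {p : Pt} (hp : p ∈ X) (α β : ℝ)
    (h : ∀ q ∈ X, q ≠ p → α * q 0 + β * q 1 < α * p 0 + β * p 1) : p ∈ E X :=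
  mem_E_of_strict_max X (fnl α β) hp fun q hq hne => by
    rw [fnl_apply, fnl_apply]; exact h q hq hne

theorem not_mem_convexHull_diff_of_mem_extremePoints {V : Type*} [AddCommGroup V] [Module ℝ V]
    {S : Set V} {p : V} (hp : p ∈ (convexHull ℝ S).extremePoints ℝ) :
    p ∉ convexHull ℝ (S \ {p}) := by
  intro hmem
  have hsub : convexHull ℝ S ⊆ convexHull ℝ (S \ {p}) := by
    refine convexHull_min (fun q hq => ?_) (convex_convexHull ℝ _)
    by_cases hqp : q = p
    · rw [hqp]; exact hmem
    · exact subset_convexHull ℝ _ ⟨hq, hqp⟩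
  have heq : convexHull ℝ (S \ {p}) = convexHull ℝ S :=
    Set.Subset.antisymm (convexHull_mono (fun x hx => hx.1)) hsub
  have hp' : p ∈ (convexHull ℝ (S \ {p})).extremePoints ℝ := by rw [heq]; exact hp
  exact (extremePoints_convexHull_subset hp').2 rfl

theorem exists_strict_functional_of_mem_E {S : Set Pt} (hS : S.Finite)
    {p : Pt} (hp : p ∈ E S) :
    p ∈ S ∧ ∃ a b : ℝ, ∀ q ∈ S, q ≠ p → a * q 0 + b * q 1 < a * p 0 + b * p 1 := by
  refine ⟨extremePoints_convexHull_subset hp, ?_⟩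
  have hnot := not_mem_convexHull_diff_of_mem_extremePoints hp
  have hclosed : IsClosed (convexHull ℝ (S \ {p})) :=
    (hS.subset (fun x hx => hx.1)).isClosed_convexHull ℝ
  obtain ⟨f, u, hfu, hup⟩ :=
    geometric_hahn_banach_closed_point (convex_convexHull ℝ (S \ {p})) hclosed hnot
  have hlin : ∀ q : Pt, f q = f (Pi.single 0 1) * q 0 + f (Pi.single 1 1) * q 1 := by
    intro q
    have hq : q = q 0 • (Pi.single 0 1 : Pt) + q 1 • (Pi.single 1 1 : Pt) := by
      funext i
      fin_cases i <;> simp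
    conv_lhs => rw [hq]
    rw [f.map_add, f.map_smul, f.map_smul, smul_eq_mul, smul_eq_mul]
    ring
  refine ⟨f (Pi.single 0 1), f (Pi.single 1 1), fun q hq hqp => ?_⟩
  rw [← hlin q, ← hlin p]
  exact (hfu q (subset_convexHull ℝ _ ⟨hq, hqp⟩)).trans hup

def LeftStrict (S : Set Pt) (v : Pt) (β : ℝ) : Prop :=
  ∀ q ∈ S, q ≠ v → -q 0 + β * q 1 < -v 0 + β * v 1

def RightStrict (S : Set Pt) (v : Pt) (β : ℝ) : Prop :=
  ∀ q ∈ S, q ≠ v → q 0 + β * q 1 < v 0 + β * v 1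

theorem left_or_right {S : Set Pt} (hS : S.Finite) {v : Pt} (hv : v ∈ E S) :
    ∃ β : ℝ, LeftStrict S v β ∨ RightStrict S v β := by
  obtain ⟨-, a, b, h⟩ := exists_strict_functional_of_mem_E hS hv
  rcases lt_trichotomy a 0 with ha | ha | ha
  · refine ⟨b / (-a), Or.inl fun q hq hne => ?_⟩
    have h1 := h q hq hne
    have hna : 0 < -a := neg_pos.2 ha
    have ha0 : a ≠ 0 := ha.ne
    have key : (-v 0 + b / (-a) * v 1) - (-q 0 + b / (-a) * q 1)
        = ((a * v 0 + b * v 1) - (a * q 0 + b * q 1)) / (-a) := by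
      field_simp
      ring
    have hpos : 0 < ((a * v 0 + b * v 1) - (a * q 0 + b * q 1)) / (-a) :=
      div_pos (by linarith) hna
    linarith
  · subst ha
    have hb : ∀ q ∈ S, q ≠ v → 0 < b * (v 1 - q 1) := fun q hq hne => by
      have := h q hq hne
      linarith
    obtain ⟨q₀, hq₀⟩ :=
      Set.exists_upper_bound_image S (fun q => (v 0 - q 0) / (b * (v 1 - q 1))) hS
    set M := (v 0 - q₀ 0) / (b * (v 1 - q₀ 1)) with hM
    refine ⟨b * (M + 1), Or.inl fun q hq hne => ?_⟩
    have hd := hb q hq hne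
    have hlt : (v 0 - q 0) / (b * (v 1 - q 1)) < M + 1 := by
      have := hq₀ q hq
      linarith
    rw [div_lt_iff₀ hd] at hlt
    linarith
  · refine ⟨b / a, Or.inr fun q hq hne => ?_⟩
    have h1 := h q hq hne
    have ha0 : a ≠ 0 := ha.ne'
    have key : (v 0 + b / a * v 1) - (q 0 + b / a * q 1)
        = ((a * v 0 + b * v 1) - (a * q 0 + b * q 1)) / a := by
      field_simp
    have hpos : 0 < ((a * v 0 + b * v 1) - (a * q 0 + b * q 1)) / a :=
      div_pos (by linarith) ha
    linarith

def xvec (a : ℝ) : Pt := fun i => if i = 0 then a else 0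

def xsh (a : ℝ) (p : Pt) : Pt := p + xvec a

@[simp] theorem xsh_zero (a : ℝ) (p : Pt) : xsh a p 0 = p 0 + a := by simp [xsh, xvec]

@[simp] theorem xsh_one (a : ℝ) (p : Pt) : xsh a p 1 = p 1 := by simp [xsh, xvec]

theorem xsh_injective (a : ℝ) : Function.Injective (xsh a) := add_left_injective _

/-- PLANAR LAYER CAPTURE: a vertex of `conv SQ` with a strict functional of negative (resp. positive)
`x`-weight survives in `conv (SQ + a e₀ ∪ SR)` (resp. `conv (SQ + b e₀ ∪ SR')`) once `SR` lies `≥ N₀` to the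
right of `a` (resp. `SR'` lies `≥ N₀` to the left of `b`) inside the height strip. -/
theorem capture (SQ : Set Pt) (hfin : SQ.Finite) (H : ℝ)
    (hQ : ∀ p ∈ SQ, 0 ≤ p 0 ∧ p 0 ≤ H ∧ 0 ≤ p 1 ∧ p 1 ≤ H) :
    ∃ N₀ : ℝ, ∀ (a b : ℝ) (SR SR' : Set Pt), SR.Finite → SR'.Finite →
      (∀ r ∈ SR, a + N₀ ≤ r 0 ∧ 0 ≤ r 1 ∧ r 1 ≤ H) →
      (∀ r ∈ SR', r 0 + N₀ ≤ b ∧ 0 ≤ r 1 ∧ r 1 ≤ H) →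
      (E SQ).ncard ≤ (E (xsh a '' SQ ∪ SR)).ncard + (E (xsh b '' SQ ∪ SR')).ncard := by
  classical
  have hEfin : (E SQ).Finite := E_finite hfin
  choose! β hβ using fun v (hv : v ∈ E SQ) => left_or_right hfin hv
  obtain ⟨v₀, hv₀⟩ := Set.exists_upper_bound_image (E SQ) (fun v => |β v|) hEfin
  set B := |β v₀| with hB
  refine ⟨H * (2 * B + 1) + 1, fun a b SR SR' hR hR' hSR hSR' => ?_⟩
  set L : Set Pt := {v | v ∈ E SQ ∧ LeftStrict SQ v (β v)} with hL
  set Rt : Set Pt := {v | v ∈ E SQ ∧ ¬ LeftStrict SQ v (β v)} with hRt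
  have hsplit : E SQ ⊆ L ∪ Rt := fun v hv => by
    by_cases h : LeftStrict SQ v (β v)
    · exact Or.inl ⟨hv, h⟩
    · exact Or.inr ⟨hv, h⟩
  have hLRfin : (L ∪ Rt).Finite :=
    hEfin.subset (Set.union_subset (fun v hv => hv.1) (fun v hv => hv.1))
  have hLsub : xsh a '' L ⊆ E (xsh a '' SQ ∪ SR) := by
    rintro _ ⟨v, ⟨hv, hleft⟩, rfl⟩
    have hvS : v ∈ SQ := E_subset _ hv
    refine mem_E_of_strict _ (Or.inl ⟨v, hvS, rfl⟩) (-1) (β v) fun q hq hne => ?_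
    rcases hq with ⟨q', hq', rfl⟩ | hqR
    · have hne' : q' ≠ v := fun h => hne (by rw [h])
      have := hleft q' hq' hne'
      simp only [xsh_zero, xsh_one]
      linarith
    · obtain ⟨h1, h2, h3⟩ := hSR q hqR
      obtain ⟨hv0, hv0', hv1, hv1'⟩ := hQ v hvS
      have hb : |β v| ≤ B := hv₀ v hv
      have hH : 0 ≤ H := le_trans hv1 hv1'
      simp only [xsh_zero, xsh_one]
      have e1 : β v * q 1 ≤ |β v| * H :=
        calc β v * q 1 ≤ |β v| * q 1 := mul_le_mul_of_nonneg_right (le_abs_self _) h2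
          _ ≤ |β v| * H := mul_le_mul_of_nonneg_left h3 (abs_nonneg _)
      have e2 : -(|β v| * H) ≤ β v * v 1 := by
        have h4 : -(|β v| * v 1) ≤ β v * v 1 := by
          have := neg_abs_le (β v)
          nlinarith
        have h5 : |β v| * v 1 ≤ |β v| * H := mul_le_mul_of_nonneg_left hv1' (abs_nonneg _)
        linarith
      have e3 : 0 ≤ (B - |β v|) * H := mul_nonneg (sub_nonneg.2 hb) hH
      nlinarith
  have hRsub : xsh b '' Rt ⊆ E (xsh b '' SQ ∪ SR') := by
    rintro _ ⟨v, ⟨hv, hnl⟩, rfl⟩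
    have hright : RightStrict SQ v (β v) := (hβ v hv).resolve_left hnl
    have hvS : v ∈ SQ := E_subset _ hv
    refine mem_E_of_strict _ (Or.inl ⟨v, hvS, rfl⟩) 1 (β v) fun q hq hne => ?_
    rcases hq with ⟨q', hq', rfl⟩ | hqR
    · have hne' : q' ≠ v := fun h => hne (by rw [h])
      have := hright q' hq' hne'
      simp only [xsh_zero, xsh_one]
      linarith
    · obtain ⟨h1, h2, h3⟩ := hSR' q hqR
      obtain ⟨hv0, hv0', hv1, hv1'⟩ := hQ v hvS
      have hb : |β v| ≤ B := hv₀ v hv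
      have hH : 0 ≤ H := le_trans hv1 hv1'
      simp only [xsh_zero, xsh_one]
      have e1 : β v * q 1 ≤ |β v| * H :=
        calc β v * q 1 ≤ |β v| * q 1 := mul_le_mul_of_nonneg_right (le_abs_self _) h2
          _ ≤ |β v| * H := mul_le_mul_of_nonneg_left h3 (abs_nonneg _)
      have e2 : -(|β v| * H) ≤ β v * v 1 := by
        have h4 : -(|β v| * v 1) ≤ β v * v 1 := by
          have := neg_abs_le (β v)
          nlinarith
        have h5 : |β v| * v 1 ≤ |β v| * H := mul_le_mul_of_nonneg_left hv1' (abs_nonneg _)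
        linarith
      have e3 : 0 ≤ (B - |β v|) * H := mul_nonneg (sub_nonneg.2 hb) hH
      nlinarith
  have hfin1 : (E (xsh a '' SQ ∪ SR)).Finite := E_finite ((hfin.image _).union hR)
  have hfin2 : (E (xsh b '' SQ ∪ SR')).Finite := E_finite ((hfin.image _).union hR')
  calc (E SQ).ncard ≤ (L ∪ Rt).ncard := Set.ncard_le_ncard hsplit hLRfin
    _ ≤ L.ncard + Rt.ncard := Set.ncard_union_le L Rt
    _ = (xsh a '' L).ncard + (xsh b '' Rt).ncard := by
        rw [Set.ncard_image_of_injective L (xsh_injective a),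
          Set.ncard_image_of_injective Rt (xsh_injective b)]
    _ ≤ (E (xsh a '' SQ ∪ SR)).ncard + (E (xsh b '' SQ ∪ SR')).ncard :=
        Nat.add_le_add (Set.ncard_le_ncard hLsub hfin1) (Set.ncard_le_ncard hRsub hfin2)

end Capture

/-! ## TRANCHE A — roots-of-unity blocks and layer expansions -/
section Algebra

open MvPolynomial Finset

abbrev P2 := MvPolynomial (Fin 2) ℂ

/-- Roots-of-unity block: `∏_{i<k} (T + ζ^i Y) = T^k + (−1)^(k+1) Y^k`. -/
theorem prod_T_add_root_mul {k : ℕ} (hk : 0 < k) {ζ : ℂ} (hζ : IsPrimitiveRoot ζ k) (T Y : P2) :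
    ∏ i ∈ range k, (T + C (ζ ^ i) * Y) = T ^ k + (-1) ^ (k + 1) * Y ^ k := by
  have hζ' : IsPrimitiveRoot (C ζ : P2) k := hζ.map_of_injective (C_injective (Fin 2) ℂ)
  have h := X_pow_sub_C_eq_prod hζ' hk (rfl : (-Y) ^ k = (-Y) ^ k)
  have h1 := congrArg (Polynomial.eval T) h
  simp only [Polynomial.eval_sub, Polynomial.eval_pow, Polynomial.eval_X, Polynomial.eval_C,
    Polynomial.eval_prod] at h1
  have h2 : ∀ i, T - (C ζ : P2) ^ i * (-Y) = T + C (ζ ^ i) * Y := fun i => by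
    rw [map_pow]; ring
  rw [Finset.prod_congr rfl (fun i _ => (h2 i).symm), ← h1, neg_pow]
  ring

theorem prod_one_add_root_mul {k : ℕ} (hk : 0 < k) {ζ : ℂ} (hζ : IsPrimitiveRoot ζ k) (Y : P2) :
    ∏ i ∈ range k, (1 + C (ζ ^ i) * Y) = 1 + (-1) ^ (k + 1) * Y ^ k := by
  have h := prod_T_add_root_mul hk hζ 1 Y
  rwa [one_pow] at h

theorem prod_T_add_root_mul_fin {k : ℕ} (hk : 0 < k) {ζ : ℂ} (hζ : IsPrimitiveRoot ζ k)
    (T Y : P2) : ∏ i : Fin k, (T + C (ζ ^ (i : ℕ)) * Y) = T ^ k + (-1) ^ (k + 1) * Y ^ k := by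
  rw [← prod_T_add_root_mul hk hζ T Y]
  exact Fin.prod_univ_eq_prod_range (fun i => T + C (ζ ^ i) * Y) k

theorem prod_one_add_root_mul_fin {k : ℕ} (hk : 0 < k) {ζ : ℂ} (hζ : IsPrimitiveRoot ζ k)
    (Y : P2) : ∏ i : Fin k, (1 + C (ζ ^ (i : ℕ)) * Y) = 1 + (-1) ^ (k + 1) * Y ^ k := by
  rw [← prod_one_add_root_mul hk hζ Y]
  exact Fin.prod_univ_eq_prod_range (fun i => 1 + C (ζ ^ i) * Y) k

/-- Layer expansion `∏ (1 + T ηᵢ) = 1 + T Σ ηᵢ + T² R` with a `y`-degree bound on `R`. -/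
theorem expand_one_add (T : P2) (hT1 : degreeOf 1 T = 0) (δ : ℕ) :
    ∀ (n : ℕ) (η : Fin n → P2), (∀ i, degreeOf 1 (η i) ≤ δ) →
      ∃ R : P2, ∏ i, (1 + T * η i) = 1 + T * (∑ i, η i) + T ^ 2 * R ∧
        degreeOf 1 R ≤ (n + 1) * δ := by
  intro n
  induction n with
  | zero =>
    intro η _
    exact ⟨0, by simp, by simp⟩
  | succ n ih =>
    intro η hη
    obtain ⟨R, hR, hRdeg⟩ := ih (fun i => η i.succ) (fun i => hη i.succ)
    refine ⟨R * (1 + T * η 0) + (∑ i : Fin n, η i.succ) * η 0, ?_, ?_⟩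
    · rw [Fin.prod_univ_succ, Fin.sum_univ_succ, hR]
      ring
    · have h1 : degreeOf 1 (1 + T * η 0) ≤ δ :=
        (degreeOf_add_le _ _ _).trans (max_le (by simp [degreeOf_one])
          ((degreeOf_mul_le _ _ _).trans (by rw [hT1, zero_add]; exact hη 0)))
      have h2 : degreeOf 1 (R * (1 + T * η 0)) ≤ (n + 1) * δ + δ :=
        (degreeOf_mul_le _ _ _).trans (add_le_add hRdeg h1)
      have h3 : degreeOf 1 (∑ i : Fin n, η i.succ) ≤ δ :=
        (degreeOf_sum_le _ _ _).trans (Finset.sup_le fun i _ => hη i.succ)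
      have h4 : degreeOf 1 ((∑ i : Fin n, η i.succ) * η 0) ≤ δ + δ :=
        (degreeOf_mul_le _ _ _).trans (add_le_add h3 (hη 0))
      refine (degreeOf_add_le _ _ _).trans (max_le (h2.trans (le_of_eq (by ring)))
        (h4.trans ?_))
      nlinarith

/-- Mirror expansion `∏ (T + ηᵢ) = T^n + T^(n−1) Σ ηᵢ + R` with degree bounds on `R` (`R = 0` if `n ≤ 1`). -/
theorem expand_T_add (T : P2) (τ δ₀ δ₁ : ℕ) (hT0 : degreeOf 0 T ≤ τ) (hT1 : degreeOf 1 T = 0) :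
    ∀ (n : ℕ) (η : Fin n → P2), (∀ i, degreeOf 0 (η i) ≤ δ₀) → (∀ i, degreeOf 1 (η i) ≤ δ₁) →
      ∃ R : P2, ∏ i, (T + η i) = T ^ n + T ^ (n - 1) * (∑ i, η i) + R ∧
        degreeOf 0 R ≤ (n - 2) * τ + n * δ₀ ∧ degreeOf 1 R ≤ n * δ₁ ∧ (n ≤ 1 → R = 0) := by
  intro n
  induction n with
  | zero =>
    intro η _ _
    exact ⟨0, by simp, by simp, by simp, fun _ => rfl⟩
  | succ m ih =>
    intro η hη0 hη1
    have hTpow0 : ∀ j, degreeOf 0 (T ^ j) ≤ j * τ := fun j =>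
      (degreeOf_pow_le _ _ _).trans (Nat.mul_le_mul_left _ hT0)
    have hTpow1 : ∀ j, degreeOf 1 (T ^ j) = 0 := fun j =>
      Nat.eq_zero_of_le_zero ((degreeOf_pow_le _ _ _).trans (by rw [hT1, mul_zero]))
    rcases (by omega : m = 0 ∨ m = 1 ∨ 2 ≤ m) with hm | hm | hm
    ·
      subst hm
      refine ⟨0, ?_, by simp, by simp, fun _ => rfl⟩
      simp
    ·
      subst hm
      refine ⟨η 1 * η 0, ?_, ?_, ?_, fun h => by omega⟩
      · simp only [Fin.prod_univ_succ, Fin.prod_univ_zero, Fin.sum_univ_succ, Fin.sum_univ_zero,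
          Fin.succ_zero_eq_one, show (1 + 1 : ℕ) - 1 = 1 from rfl, pow_one]
        ring
      · refine (degreeOf_mul_le _ _ _).trans ((add_le_add (hη0 1) (hη0 0)).trans ?_)
        show δ₀ + δ₀ ≤ (1 + 1 - 2) * τ + (1 + 1) * δ₀
        omega
      · refine (degreeOf_mul_le _ _ _).trans ((add_le_add (hη1 1) (hη1 0)).trans ?_)
        show δ₁ + δ₁ ≤ (1 + 1) * δ₁
        omega
    ·
      obtain ⟨m'', rfl⟩ : ∃ m'', m = m'' + 1 + 1 := ⟨m - 2, by omega⟩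
      obtain ⟨R', hR', hR'0, hR'1, -⟩ := ih (fun i => η i.succ) (fun i => hη0 i.succ)
        (fun i => hη1 i.succ)
      have ea : m'' + 1 + 1 - 1 = m'' + 1 := by omega
      have eb : m'' + 1 + 1 - 2 = m'' := by omega
      have ec : m'' + 1 + 1 + 1 - 1 = m'' + 1 + 1 := by omega
      have ed : m'' + 1 + 1 + 1 - 2 = m'' + 1 := by omega
      rw [ea] at hR'
      rw [eb] at hR'0
      set σ' : P2 := ∑ i : Fin (m'' + 1 + 1), η i.succ with hσ'
      have hσ0 : degreeOf 0 σ' ≤ δ₀ :=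
        (degreeOf_sum_le _ _ _).trans (Finset.sup_le fun i _ => hη0 i.succ)
      have hσ1 : degreeOf 1 σ' ≤ δ₁ :=
        (degreeOf_sum_le _ _ _).trans (Finset.sup_le fun i _ => hη1 i.succ)
      refine ⟨T ^ (m'' + 1) * σ' * η 0 + R' * T + R' * η 0, ?_, ?_, ?_, fun h => by omega⟩
      · rw [Fin.prod_univ_succ, Fin.sum_univ_succ, hR', ec]
        ring
      ·
        rw [ed]
        have e1 : degreeOf 0 (T ^ (m'' + 1) * σ' * η 0) ≤ (m'' + 1) * τ + δ₀ + δ₀ :=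
          (degreeOf_mul_le _ _ _).trans (add_le_add ((degreeOf_mul_le _ _ _).trans
            (add_le_add (hTpow0 (m'' + 1)) hσ0)) (hη0 0))
        have e2 : degreeOf 0 (R' * T) ≤ m'' * τ + (m'' + 1 + 1) * δ₀ + τ :=
          (degreeOf_mul_le _ _ _).trans (add_le_add hR'0 hT0)
        have e3 : degreeOf 0 (R' * η 0) ≤ m'' * τ + (m'' + 1 + 1) * δ₀ + δ₀ :=
          (degreeOf_mul_le _ _ _).trans (add_le_add hR'0 (hη0 0))
        refine (degreeOf_add_le _ _ _).trans (max_le ((degreeOf_add_le _ _ _).trans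
          (max_le (e1.trans ?_) (e2.trans ?_))) (e3.trans ?_)) <;> nlinarith
      ·
        have e1 : degreeOf 1 (T ^ (m'' + 1) * σ' * η 0) ≤ 0 + δ₁ + δ₁ :=
          (degreeOf_mul_le _ _ _).trans (add_le_add ((degreeOf_mul_le _ _ _).trans
            (add_le_add (hTpow1 (m'' + 1)).le hσ1)) (hη1 0))
        have e2 : degreeOf 1 (R' * T) ≤ (m'' + 1 + 1) * δ₁ + 0 :=
          (degreeOf_mul_le _ _ _).trans (add_le_add hR'1 hT1.le)
        have e3 : degreeOf 1 (R' * η 0) ≤ (m'' + 1 + 1) * δ₁ + δ₁ :=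
          (degreeOf_mul_le _ _ _).trans (add_le_add hR'1 (hη1 0))
        refine (degreeOf_add_le _ _ _).trans (max_le ((degreeOf_add_le _ _ _).trans
          (max_le (e1.trans ?_) (e2.trans ?_))) (e3.trans ?_)) <;> nlinarith

end Algebra

/-! ## TRANCHE W — finite-difference Waring designs -/
section Waring

open Finset Nat
open scoped fwdDiff

variable {A : Type*} [CommRing A]

def zw (n m : ℕ) : ℤ := (-1) ^ (n - m) * (n.choose m : ℤ)

noncomputable def Dval (A : Type*) [CommRing A] (n a : ℕ) : A :=
  (fwdDiff (1 : A))^[n] (fun r : A => r ^ a) 0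

theorem Dval_eq_sum (n a : ℕ) :
    Dval A n a = ∑ m ∈ range (n + 1), (zw n m : A) * (m : A) ^ a := by
  unfold Dval
  rw [fwdDiff_iter_eq_sum_shift]
  refine Finset.sum_congr rfl fun m _ => ?_
  rw [zsmul_eq_mul]
  simp [zw]

theorem Dval_of_lt {n a : ℕ} (h : a < n) : Dval A n a = 0 := by
  unfold Dval
  rw [fwdDiff_iter_pow_eq_zero_of_lt h]
  rfl

theorem Dval_self (n : ℕ) : Dval A n n = (n ! : A) := by
  unfold Dval
  rw [fwdDiff_iter_eq_factorial]
  rfl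

theorem sum_zw_mul_add_pow (n : ℕ) (y B : A) (i : ℕ) :
    ∑ m ∈ range (n + 1), (zw n m : A) * (y + (m : A) * B) ^ i
      = ∑ a ∈ range (i + 1), (i.choose a : A) * B ^ a * Dval A n a * y ^ (i - a) := by
  calc ∑ m ∈ range (n + 1), (zw n m : A) * (y + (m : A) * B) ^ i
      = ∑ m ∈ range (n + 1), ∑ a ∈ range (i + 1),
          (zw n m : A) * (((m : A) * B) ^ a * y ^ (i - a) * (i.choose a : A)) := by
        refine Finset.sum_congr rfl fun m _ => ?_
        rw [add_comm y, add_pow, Finset.mul_sum]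
    _ = ∑ a ∈ range (i + 1), ∑ m ∈ range (n + 1),
          (zw n m : A) * (((m : A) * B) ^ a * y ^ (i - a) * (i.choose a : A)) := Finset.sum_comm
    _ = ∑ a ∈ range (i + 1), (i.choose a : A) * B ^ a * Dval A n a * y ^ (i - a) := by
        refine Finset.sum_congr rfl fun a _ => ?_
        rw [Dval_eq_sum, Finset.mul_sum, Finset.sum_mul]
        refine Finset.sum_congr rfl fun m _ => ?_
        ring

def IsDesign {ι : Type*} [Fintype ι] (W : ι → ℤ) (sh : ι → A) (T : ℕ) (Pv : A) : Prop :=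
  ∀ (c : A) (i : ℕ), i ≤ T → ∑ j, (W j : A) * (c + sh j) ^ i = if i = T then (T ! : A) * Pv else 0

theorem isDesign_unit : IsDesign (fun _ : Unit => (1 : ℤ)) (fun _ => (0 : A)) 0 1 := by
  intro c i hi
  obtain rfl : i = 0 := Nat.le_zero.mp hi
  simp

theorem isDesign_step {ι : Type*} [Fintype ι] {W : ι → ℤ} {sh : ι → A} {T : ℕ} {Pv : A}
    (hD : IsDesign W sh T Pv) (n : ℕ) (B : A) :
    IsDesign (fun p : ι × Fin (n + 1) => W p.1 * zw n (p.2 : ℕ))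
      (fun p => sh p.1 + ((p.2 : ℕ) : A) * B) (T + n) (Pv * B ^ n) := by
  intro c i hi
  have h1 : ∑ p : ι × Fin (n + 1), ((W p.1 * zw n (p.2 : ℕ) : ℤ) : A) * (c + (sh p.1 + ((p.2 : ℕ) : A) * B)) ^ i
      = ∑ a ∈ range (i + 1), (i.choose a : A) * B ^ a * Dval A n a *
          ∑ j, (W j : A) * (c + sh j) ^ (i - a) := by
    rw [Fintype.sum_prod_type]
    have h2 : ∀ j : ι, ∑ m : Fin (n + 1), ((W j * zw n (m : ℕ) : ℤ) : A) *
          (c + (sh j + ((m : ℕ) : A) * B)) ^ i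
        = (W j : A) * ∑ a ∈ range (i + 1), (i.choose a : A) * B ^ a * Dval A n a *
            (c + sh j) ^ (i - a) := by
      intro j
      rw [← sum_zw_mul_add_pow n (c + sh j) B i, Finset.mul_sum]
      rw [Fin.sum_univ_eq_sum_range (fun m => ((W j * zw n m : ℤ) : A) *
          (c + (sh j + (m : A) * B)) ^ i) (n + 1)]
      refine Finset.sum_congr rfl fun m _ => ?_
      push_cast
      ring
    simp_rw [h2]
    simp_rw [Finset.mul_sum]
    rw [Finset.sum_comm]
    refine Finset.sum_congr rfl fun a _ => ?_
    refine Finset.sum_congr rfl fun j _ => ?_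
    ring
  rw [h1]
  have hterm : ∀ a ∈ range (i + 1), a ≠ n →
      (i.choose a : A) * B ^ a * Dval A n a * ∑ j, (W j : A) * (c + sh j) ^ (i - a) = 0 := by
    intro a ha hne
    have har := mem_range.mp ha
    rcases lt_or_gt_of_ne hne with hlt | hgt
    · rw [Dval_of_lt hlt]; ring
    · have hle : i - a ≤ T := by omega
      have hneT : i - a ≠ T := by omega
      rw [hD c (i - a) hle, if_neg hneT]; ring
  by_cases hi' : i = T + n
  · subst hi'
    rw [if_pos rfl, Finset.sum_eq_single n hterm (fun h => (h (mem_range.mpr (by omega))).elim)]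
    rw [Dval_self, hD c (T + n - n) (by omega), Nat.add_sub_cancel, if_pos rfl]
    have hnat : ((T + n).choose n * n ! * T ! : ℕ) = (T + n) ! := by
      have := Nat.choose_mul_factorial_mul_factorial (Nat.le_add_left n T)
      rwa [Nat.add_sub_cancel] at this
    calc ((T + n).choose n : A) * B ^ n * (n ! : A) * ((T ! : A) * Pv)
        = (((T + n).choose n * n ! * T ! : ℕ) : A) * Pv * B ^ n := by push_cast; ring
      _ = ((T + n) ! : A) * (Pv * B ^ n) := by rw [hnat]; ring
  · rw [if_neg hi']
    refine Finset.sum_eq_zero fun a ha => ?_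
    have har := mem_range.mp ha
    by_cases han : a = n
    · subst han
      have hle : i - a ≤ T := by omega
      have hneT : i - a ≠ T := by omega
      rw [hD c (i - a) hle, if_neg hneT]; ring
    · exact hterm a ha han

abbrev DIdx (β : Fin 4 → ℕ) : Type :=
  (((Unit × Fin (β 0 + 1)) × Fin (β 1 + 1)) × Fin (β 2 + 1)) × Fin (β 3 + 1)

def dW (β : Fin 4 → ℕ) (J : DIdx β) : ℤ :=
  (((1 : ℤ) * zw (β 0) (J.1.1.1.2 : ℕ)) * zw (β 1) (J.1.1.2 : ℕ)) * zw (β 2) (J.1.2 : ℕ) *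
    zw (β 3) (J.2 : ℕ)

def dM (β : Fin 4 → ℕ) (J : DIdx β) : Fin 4 → ℕ :=
  ![(J.1.1.1.2 : ℕ), (J.1.1.2 : ℕ), (J.1.2 : ℕ), (J.2 : ℕ)]

theorem dM_le (β : Fin 4 → ℕ) (J : DIdx β) (l : Fin 4) : dM β J l ≤ β l := by
  fin_cases l
  · show (J.1.1.1.2 : ℕ) ≤ β 0; have := J.1.1.1.2.isLt; omega
  · show (J.1.1.2 : ℕ) ≤ β 1; have := J.1.1.2.isLt; omega
  · show (J.1.2 : ℕ) ≤ β 2; have := J.1.2.isLt; omega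
  · show (J.2 : ℕ) ≤ β 3; have := J.2.isLt; omega

def dSh (β : Fin 4 → ℕ) (B : Fin 4 → A) (J : DIdx β) : A :=
  (((0 + ((J.1.1.1.2 : ℕ) : A) * B 0) + ((J.1.1.2 : ℕ) : A) * B 1) + ((J.1.2 : ℕ) : A) * B 2) +
    ((J.2 : ℕ) : A) * B 3

theorem dSh_eq (β : Fin 4 → ℕ) (B : Fin 4 → A) (J : DIdx β) :
    dSh β B J = ∑ l : Fin 4, ((dM β J l : ℕ) : A) * B l := by
  simp [dSh, dM, Fin.sum_univ_four]

theorem card_DIdx (β : Fin 4 → ℕ) : Fintype.card (DIdx β) = ∏ l : Fin 4, (β l + 1) := by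
  simp [DIdx, Fin.prod_univ_four]

theorem design4_isDesign (β : Fin 4 → ℕ) (B : Fin 4 → A) :
    IsDesign (dW β) (dSh β B) (((0 + β 0) + β 1) + β 2 + β 3)
      ((((1 : A) * B 0 ^ β 0) * B 1 ^ β 1) * B 2 ^ β 2 * B 3 ^ β 3) := by
  have h0 := isDesign_unit (A := A)
  have h1 := isDesign_step h0 (β 0) (B 0)
  have h2 := isDesign_step h1 (β 1) (B 1)
  have h3 := isDesign_step h2 (β 2) (B 2)
  have h4 := isDesign_step h3 (β 3) (B 3)
  exact h4

/-- EXPLICIT WARING DESIGN (iterated finite differences, (d) of #112):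
`Σ_{j ≤ β} (−1)^{|β|−|j|} C(β,j) ⟨j, B⟩^{|β|} = |β|! · B^β` for four letters. -/
theorem waring_monomial4 (β : Fin 4 → ℕ) (B : Fin 4 → A) :
    ∑ J : DIdx β, (dW β J : A) * (∑ l : Fin 4, ((dM β J l : ℕ) : A) * B l) ^ (∑ l, β l)
      = ((∑ l, β l) ! : A) * ∏ l, B l ^ β l := by
  have h := design4_isDesign β B 0 (∑ l, β l) (by simp [Fin.sum_univ_four])
  have hT : (∑ l : Fin 4, β l) = ((0 + β 0) + β 1) + β 2 + β 3 := by simp [Fin.sum_univ_four]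
  rw [if_pos hT] at h
  simp_rw [zero_add, dSh_eq] at h
  have hT' : (∑ l : Fin 4, β l) = β 0 + β 1 + β 2 + β 3 := by simp [Fin.sum_univ_four]
  rw [h, ← hT']
  simp [Fin.prod_univ_four]

end Waring

/-! ## TRANCHE S+F — supports, sparsity, the kernel proof of `LayerEmbedding`, corollaries -/


section Assembly

open MvPolynomial Finset
open Summit.ValiantsHypothesis.ValiantsHypothesis.Cruxes.TwoProducts.ValIdea35g10 (Poly2 Poly3 emb nv)

noncomputable def Zm (N : ℕ) : Poly2 := X 0 ^ N

theorem Zm_pow (N K : ℕ) : Zm N ^ K = Zm (N * K) := by rw [Zm, Zm, ← pow_mul]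

theorem degreeOf_zero_Zm (N : ℕ) : degreeOf 0 (Zm N) ≤ N := by
  refine (degreeOf_pow_le _ _ _).trans ?_
  rw [degreeOf_X]
  simp

theorem degreeOf_one_Zm (N : ℕ) : degreeOf 1 (Zm N) = 0 := by
  apply Nat.eq_zero_of_le_zero
  refine (degreeOf_pow_le _ _ _).trans ?_
  rw [degreeOf_X]
  simp

theorem mem_support_Zm_mul {N : ℕ} {Q : Poly2} {m : Fin 2 →₀ ℕ} :
    m ∈ (Zm N * Q).support ↔ Finsupp.single 0 N ≤ m ∧ (m - Finsupp.single 0 N) ∈ Q.support := by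
  rw [Zm, X_pow_eq_monomial, mem_support_iff, coeff_monomial_mul', mem_support_iff]
  by_cases h : Finsupp.single (0 : Fin 2) N ≤ m <;> simp [h]

theorem support_Zm_mul (N : ℕ) (Q : Poly2) :
    (Zm N * Q).support = Q.support.map (addLeftEmbedding (Finsupp.single 0 N)) := by
  ext m
  rw [mem_support_Zm_mul, Finset.mem_map]
  constructor
  · rintro ⟨hle, hm⟩
    exact ⟨m - Finsupp.single 0 N, hm, by rw [addLeftEmbedding_apply, add_tsub_cancel_of_le hle]⟩
  · rintro ⟨m', hm', rfl⟩
    rw [addLeftEmbedding_apply]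
    exact ⟨le_self_add, by rwa [add_tsub_cancel_left]⟩

theorem card_support_Zm_mul (N : ℕ) (Q : Poly2) : (Zm N * Q).support.card = Q.support.card := by
  rw [support_Zm_mul, Finset.card_map]

theorem x_ge_of_mem_support_Zm_mul {N : ℕ} {Q : Poly2} {m : Fin 2 →₀ ℕ}
    (hm : m ∈ (Zm N * Q).support) : N ≤ m 0 :=
  Finsupp.single_le_iff.mp (mem_support_Zm_mul.mp hm).1

theorem x_le_of_mem_support_Zm_mul {N : ℕ} {Q : Poly2} {m : Fin 2 →₀ ℕ}
    (hm : m ∈ (Zm N * Q).support) : m 0 ≤ N + degreeOf 0 Q := by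
  obtain ⟨hle, hm'⟩ := mem_support_Zm_mul.mp hm
  have h1 : ((m - Finsupp.single 0 N : Fin 2 →₀ ℕ) : Fin 2 →₀ ℕ) 0 ≤ degreeOf 0 Q :=
    (degreeOf_le_iff.mp le_rfl) _ hm'
  simp only [Finsupp.coe_tsub, Pi.sub_apply, Finsupp.single_eq_same] at h1
  omega

theorem y_le_of_mem_support_Zm_mul {N : ℕ} {Q : Poly2} {m : Fin 2 →₀ ℕ}
    (hm : m ∈ (Zm N * Q).support) : m 1 ≤ degreeOf 1 Q := by
  obtain ⟨hle, hm'⟩ := mem_support_Zm_mul.mp hm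
  have h1 : ((m - Finsupp.single 0 N : Fin 2 →₀ ℕ) : Fin 2 →₀ ℕ) 1 ≤ degreeOf 1 Q :=
    (degreeOf_le_iff.mp le_rfl) _ hm'
  simpa [Finsupp.single_eq_of_ne] using h1

theorem le_degreeOf_of_mem_support {Q : Poly2} {m : Fin 2 →₀ ℕ} (hm : m ∈ Q.support) (v : Fin 2) :
    m v ≤ degreeOf v Q := (degreeOf_le_iff.mp le_rfl) _ hm

theorem emb_apply' (m : Fin 2 →₀ ℕ) (i : Fin 2) : emb m i = ((m i : ℕ) : ℝ) := rfl

theorem emb_add_single (N : ℕ) (m : Fin 2 →₀ ℕ) :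
    emb (Finsupp.single 0 N + m) = xsh (N : ℝ) (emb m) := by
  funext i
  fin_cases i
  · simp [emb_apply', xsh, xvec, add_comm]
  · simp [emb_apply', xsh, xvec]

theorem emb_image_support_Zm_mul (N : ℕ) (Q : Poly2) :
    emb '' ((Zm N * Q).support : Set _)
      = xsh (N : ℝ) '' (emb '' (Q.support : Set _)) := by
  rw [support_Zm_mul, Finset.coe_map, Set.image_image, Set.image_image]
  refine Set.image_congr fun m _ => ?_
  rw [addLeftEmbedding_apply, emb_add_single]

theorem support_add_eq_of_disjoint {A B : Poly2} (h : ∀ m ∈ A.support, m ∉ B.support) :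
    (A + B).support = A.support ∪ B.support := by
  ext m
  simp only [Finset.mem_union, mem_support_iff, coeff_add]
  constructor
  · intro hm
    by_contra hcon
    simp only [not_or, not_not] at hcon
    rw [hcon.1, hcon.2, add_zero] at hm
    exact hm rfl
  · rintro (hA | hB)
    · have hB : coeff m B = 0 := by
        by_contra hB
        exact h m (mem_support_iff.mpr hA) (mem_support_iff.mpr hB)
      rw [hB, add_zero]; exact hA
    · have hA : coeff m A = 0 := by
        by_contra hA
        exact h m (mem_support_iff.mpr hA) (mem_support_iff.mpr hB)
      rw [hA, zero_add]; exact hB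

theorem card_support_add_le (A B : Poly2) :
    (A + B).support.card ≤ A.support.card + B.support.card := by
  classical
  exact (Finset.card_le_card support_add).trans (Finset.card_union_le _ _)

theorem card_support_C_mul_le (c : ℂ) (A : Poly2) : (C c * A).support.card ≤ A.support.card := by
  rw [← smul_eq_C_mul]
  exact Finset.card_le_card support_smul

theorem card_support_natCast_mul_le (m : ℕ) (A : Poly2) :
    ((m : Poly2) * A).support.card ≤ A.support.card := by
  rw [← map_natCast (C : ℂ →+* Poly2) m]
  exact card_support_C_mul_le _ _

theorem card_support_sum_le {ι : Type*} (s : Finset ι) (f : ι → Poly2) :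
    (∑ i ∈ s, f i).support.card ≤ ∑ i ∈ s, (f i).support.card := by
  classical
  exact (Finset.card_le_card support_sum).trans Finset.card_biUnion_le

theorem card_support_one_le : (1 : Poly2).support.card ≤ 1 := by simp

theorem card_support_Zm_le (N : ℕ) : (Zm N).support.card ≤ 1 := by
  simp [Zm, support_X_pow]

theorem degreeOf_natCast_mul_le (v : Fin 2) (m : ℕ) (A : Poly2) :
    degreeOf v ((m : Poly2) * A) ≤ degreeOf v A := by
  rw [← map_natCast (C : ℂ →+* Poly2) m]
  exact degreeOf_C_mul_le _ _ _

noncomputable def letters (w : Fin 3 → Poly2) : Fin 4 → Poly2 := ![1, w 0, w 1, w 2]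

noncomputable def dmax (w : Fin 3 → Poly2) : ℕ := ∑ i, (degreeOf 0 (w i) + degreeOf 1 (w i))

theorem degreeOf_w_le (w : Fin 3 → Poly2) (v : Fin 2) (i : Fin 3) : degreeOf v (w i) ≤ dmax w := by
  have h : degreeOf 0 (w i) + degreeOf 1 (w i) ≤ dmax w :=
    Finset.single_le_sum (f := fun i => degreeOf 0 (w i) + degreeOf 1 (w i))
      (fun _ _ => Nat.zero_le _) (Finset.mem_univ i)
  fin_cases v
  · exact le_trans (Nat.le_add_right _ _) h
  · exact le_trans (Nat.le_add_left _ _) h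

theorem degreeOf_letters_le (w : Fin 3 → Poly2) (v : Fin 2) (l : Fin 4) :
    degreeOf v (letters w l) ≤ dmax w := by
  fin_cases l
  · show degreeOf v (1 : Poly2) ≤ dmax w
    rw [degreeOf_one]; exact Nat.zero_le _
  · exact degreeOf_w_le w v 0
  · exact degreeOf_w_le w v 1
  · exact degreeOf_w_le w v 2

theorem card_support_letters_le (w : Fin 3 → Poly2) (t : ℕ) (hw : ∀ i, (w i).support.card ≤ t)
    (l : Fin 4) : (letters w l).support.card ≤ if l = 0 then 1 else t := by
  fin_cases l
  · simp [letters]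
  · simpa [letters] using hw 0
  · simpa [letters] using hw 1
  · simpa [letters] using hw 2

noncomputable def linForm (w : Fin 3 → Poly2) (m : Fin 4 → ℕ) : Poly2 := ∑ l, ((m l : ℕ) : Poly2) * letters w l

theorem card_support_linForm_le (w : Fin 3 → Poly2) (t : ℕ) (hw : ∀ i, (w i).support.card ≤ t)
    (m : Fin 4 → ℕ) : (linForm w m).support.card ≤ 3 * t + 1 := by
  unfold linForm
  refine (card_support_sum_le _ _).trans ?_
  have h : ∀ l, (((m l : ℕ) : Poly2) * letters w l).support.card ≤ if l = 0 then 1 else t :=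
    fun l => (card_support_natCast_mul_le _ _).trans (card_support_letters_le w t hw l)
  calc ∑ l, (((m l : ℕ) : Poly2) * letters w l).support.card
      ≤ ∑ l : Fin 4, (if l = 0 then 1 else t) := Finset.sum_le_sum fun l _ => h l
    _ = 3 * t + 1 := by simp [Fin.sum_univ_four]; ring

theorem degreeOf_linForm_le (w : Fin 3 → Poly2) (m : Fin 4 → ℕ) (v : Fin 2) :
    degreeOf v (linForm w m) ≤ dmax w := by
  unfold linForm
  refine (degreeOf_sum_le _ _ _).trans (Finset.sup_le fun l _ => ?_)
  exact (degreeOf_natCast_mul_le _ _ _).trans (degreeOf_letters_le w v l)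

theorem card_support_le_of_totalDegree (k : ℕ) (P : Poly3) (hP : P.totalDegree ≤ k) :
    P.support.card ≤ (k + 1) ^ 3 := by
  classical
  have hmaps : ∀ α ∈ P.support, (⇑α : Fin 3 → ℕ) ∈ Fintype.piFinset fun _ : Fin 3 => Finset.range (k + 1) := by
    intro α hα
    rw [Fintype.mem_piFinset]
    intro l
    rw [Finset.mem_range]
    have h1 : α l ≤ degreeOf l P := (degreeOf_le_iff.mp le_rfl) _ hα
    have h2 : degreeOf l P ≤ P.totalDegree := degreeOf_le_totalDegree P l
    omega
  have hinj : Set.InjOn (fun α : Fin 3 →₀ ℕ => (⇑α : Fin 3 → ℕ)) P.support :=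
    fun a _ b _ h => DFunLike.coe_injective h
  calc P.support.card ≤ (Fintype.piFinset fun _ : Fin 3 => Finset.range (k + 1)).card :=
        Finset.card_le_card_of_injOn _ hmaps hinj
    _ = (k + 1) ^ 3 := by simp [Fintype.card_piFinset]

def bexp (K : ℕ) (α : Fin 3 →₀ ℕ) : Fin 4 → ℕ := ![K - (α 0 + α 1 + α 2), α 0, α 1, α 2]

theorem sum_bexp (K : ℕ) (α : Fin 3 →₀ ℕ) (h : α 0 + α 1 + α 2 ≤ K) : ∑ l, bexp K α l = K := by
  simp [bexp, Fin.sum_univ_four]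
  omega

theorem bexp_le (K : ℕ) (α : Fin 3 →₀ ℕ) (h : α 0 + α 1 + α 2 ≤ K) (l : Fin 4) : bexp K α l ≤ K := by
  fin_cases l <;> simp [bexp] <;> omega

theorem prod_letters_pow_bexp (K : ℕ) (α : Fin 3 →₀ ℕ) (w : Fin 3 → Poly2) :
    ∏ l, letters w l ^ bexp K α l = ∏ i, w i ^ α i := by
  simp [letters, bexp, Fin.prod_univ_four, Fin.prod_univ_three]

theorem card_DIdx_le (K : ℕ) (α : Fin 3 →₀ ℕ) (h : α 0 + α 1 + α 2 ≤ K) :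
    Fintype.card (DIdx (bexp K α)) ≤ (K + 1) ^ 4 := by
  rw [card_DIdx]
  calc ∏ l, (bexp K α l + 1) ≤ ∏ _l : Fin 4, (K + 1) :=
        Finset.prod_le_prod' fun l _ => Nat.succ_le_succ (bexp_le K α h l)
    _ = (K + 1) ^ 4 := by simp

def Msize (k : ℕ) : ℕ := (3 * k + 3) ^ 8

/-- **THE LAYER EMBEDDING HOLDS (kernel)**, `Msize k = (3k+3)^8`.  Construction: `K = 3k+1`, a primitive
`K`-th root `ζ`, the Waring design of `waring_monomial4` over `supp P` (linear forms `L_s`, weights `cW s`,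
`K`-th roots `μ_s`), factors `1 + x^N ζ^i μ_s L_s` / `x^N + ζ^i μ_s L_s` against the trivial products `∏ 1` /
`∏ x^N`; the two differences are `x^a·P(w) + x^{2a} R` and `x^b·P(w) + R'` (`a = NK`), and `capture`
with `N` chosen AFTER `(P, w)` gives `nv (P(w)) ≤ nv D + nv D'`. -/
theorem layerEmbedding_holds : LayerEmbedding Msize := by
  classical
  intro k t P w hP hw
  set Q : Poly2 := MvPolynomial.aeval w P with hQdef
  clear_value Q
  by_cases hQ0 : Q = 0
  · refine ⟨0, Fin.elim0, Fin.elim0, Fin.elim0, Fin.elim0, Nat.zero_le _, ?_, ?_, ?_, ?_, ?_⟩ <;>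
      try exact fun j => Fin.elim0 j
    have : nv Q = 0 := by
      rw [hQ0]; simp [nv]
    rw [this]; exact Nat.zero_le _
  obtain ⟨K, hKdef⟩ : ∃ K : ℕ, K = 3 * k + 1 := ⟨_, rfl⟩
  have hKpos : 0 < K := by omega
  have hdegα : ∀ α ∈ P.support, α 0 + α 1 + α 2 ≤ K := by
    intro α hα
    have h : ∀ l, α l ≤ k := fun l =>
      ((degreeOf_le_iff.mp le_rfl) _ hα).trans ((degreeOf_le_totalDegree P l).trans hP)
    have := h 0; have := h 1; have := h 2
    omega
  obtain ⟨ζ, hζ⟩ : ∃ ζ : ℂ, IsPrimitiveRoot ζ K := ⟨_, Complex.isPrimitiveRoot_exp K hKpos.ne'⟩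
  let S : Type := Σ α : P.support, DIdx (bexp K α.1)
  let Ls : S → Poly2 := fun s => linForm w (dM (bexp K s.1.1) s.2)
  let cW : S → ℂ := fun s => (P.coeff s.1.1 / (K.factorial : ℂ)) * (dW (bexp K s.1.1) s.2 : ℂ)
  have hroot : ∀ s : S, ∃ μ : ℂ, μ ^ K = (-1) ^ (K + 1) * cW s := fun s =>
    IsAlgClosed.exists_pow_nat_eq _ hKpos
  choose μ hμ using hroot
  let η : S → Poly2 := fun s => C (cW s) * Ls s ^ K
  obtain ⟨δ, hδ⟩ : ∃ δ : ℕ, δ = K * dmax w := ⟨_, rfl⟩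
  have hη0 : ∀ s, degreeOf 0 (η s) ≤ δ := fun s => hδ ▸
    (degreeOf_C_mul_le _ _ _).trans ((degreeOf_pow_le _ _ _).trans (Nat.mul_le_mul_left _ (degreeOf_linForm_le w _ 0)))
  have hη1 : ∀ s, degreeOf 1 (η s) ≤ δ := fun s => hδ ▸
    (degreeOf_C_mul_le _ _ _).trans ((degreeOf_pow_le _ _ _).trans (Nat.mul_le_mul_left _ (degreeOf_linForm_le w _ 1)))
  have hsum : ∑ s : S, η s = Q := by
    have hfact : (K.factorial : ℂ) ≠ 0 := Nat.cast_ne_zero.mpr (Nat.factorial_ne_zero K)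
    have hinner : ∀ α : P.support,
        ∑ J : DIdx (bexp K α.1), η ⟨α, J⟩ = C (P.coeff α.1) * ∏ i, w i ^ (α.1 i) := by
      intro α
      have hW := waring_monomial4 (bexp K α.1) (letters w)
      rw [sum_bexp K α.1 (hdegα α.1 α.2), prod_letters_pow_bexp] at hW
      have : ∀ J : DIdx (bexp K α.1), η ⟨α, J⟩
          = C (P.coeff α.1 / (K.factorial : ℂ)) *
            ((dW (bexp K α.1) J : Poly2) * (∑ l, ((dM (bexp K α.1) J l : ℕ) : Poly2) * letters w l) ^ K) := by
        intro J
        show C ((P.coeff α.1 / (K.factorial : ℂ)) * (dW (bexp K α.1) J : ℂ)) * (linForm w _) ^ K = _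
        rw [map_mul, map_intCast, linForm]
        ring
      simp_rw [this]
      rw [← Finset.mul_sum, hW, ← mul_assoc, ← map_natCast (C : ℂ →+* Poly2), ← map_mul,
        div_mul_cancel₀ _ hfact]
    calc ∑ s : S, η s = ∑ α : P.support, ∑ J : DIdx (bexp K α.1), η ⟨α, J⟩ := Fintype.sum_sigma _
      _ = ∑ α : P.support, C (P.coeff α.1) * ∏ i, w i ^ (α.1 i) := Fintype.sum_congr _ _ hinner
      _ = ∑ α ∈ P.support, C (P.coeff α) * ∏ i, w i ^ (α i) :=
          Finset.sum_coe_sort P.support (fun α => C (P.coeff α) * ∏ i, w i ^ (α i))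
      _ = Q := by
        rw [hQdef, MvPolynomial.aeval_def, MvPolynomial.eval₂_eq', MvPolynomial.algebraMap_eq]
  obtain ⟨n', hn'⟩ : ∃ n' : ℕ, n' = Fintype.card S := ⟨_, rfl⟩
  obtain ⟨e'⟩ : Nonempty (S ≃ Fin n') := by rw [hn']; exact ⟨Fintype.equivFin S⟩
  let η' : Fin n' → Poly2 := fun j => η (e'.symm j)
  have hη'0 : ∀ j, degreeOf 0 (η' j) ≤ δ := fun j => hη0 _
  have hη'1 : ∀ j, degreeOf 1 (η' j) ≤ δ := fun j => hη1 _
  have hsum' : ∑ j, η' j = Q := by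
    rw [← hsum]
    exact (Fintype.sum_equiv e'.symm _ _ fun j => rfl)
  have hQ0deg : degreeOf 0 Q ≤ δ := by
    rw [← hsum]; exact (degreeOf_sum_le _ _ _).trans (Finset.sup_le fun s _ => hη0 s)
  have hQ1deg : degreeOf 1 Q ≤ δ := by
    rw [← hsum]; exact (degreeOf_sum_le _ _ _).trans (Finset.sup_le fun s _ => hη1 s)
  obtain ⟨Hn, hHn⟩ : ∃ Hn : ℕ, Hn = (n' + 2) * δ := ⟨_, rfl⟩
  have hδH : δ ≤ Hn := by
    rw [hHn]; exact le_mul_of_one_le_left (Nat.zero_le _) (by omega)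
  have hn1δH : (n' + 1) * δ ≤ Hn := by rw [hHn]; exact Nat.mul_le_mul_right δ (by omega)
  have hnδH : n' * δ ≤ Hn := by rw [hHn]; exact Nat.mul_le_mul_right δ (by omega)
  have castle : ∀ {u v : ℕ}, u ≤ v → ((u : ℕ) : ℝ) ≤ ((v : ℕ) : ℝ) := fun h => Nat.cast_le.mpr h
  have hQbox : ∀ p ∈ emb '' (Q.support : Set _),
      0 ≤ p 0 ∧ p 0 ≤ (Hn : ℝ) ∧ 0 ≤ p 1 ∧ p 1 ≤ (Hn : ℝ) := by
    rintro _ ⟨m, hm, rfl⟩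
    have h0 : m 0 ≤ Hn := ((le_degreeOf_of_mem_support hm 0).trans hQ0deg).trans hδH
    have h1 : m 1 ≤ Hn := ((le_degreeOf_of_mem_support hm 1).trans hQ1deg).trans hδH
    exact ⟨Nat.cast_nonneg _, castle h0, Nat.cast_nonneg _, castle h1⟩
  obtain ⟨N₀, hcap⟩ := capture _ (Set.toFinite _) (Hn : ℝ) hQbox
  obtain ⟨N, hN⟩ : ∃ N : ℕ, N = ⌈N₀⌉₊ + n' * δ + δ + 1 := ⟨_, rfl⟩
  have hN₀N : N₀ ≤ (N : ℝ) := by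
    have h1 : ((⌈N₀⌉₊ : ℕ) : ℝ) ≤ ((N : ℕ) : ℝ) := castle (by rw [hN]; omega)
    exact (Nat.le_ceil N₀).trans h1
  obtain ⟨a, ha⟩ : ∃ a : ℕ, a = N * K := ⟨_, rfl⟩
  have hNa : N ≤ a := by rw [ha]; exact Nat.le_mul_of_pos_right N hKpos
  have hZa : Zm N ^ K = Zm a := by rw [Zm_pow, ha]
  obtain ⟨R, hR, hRdeg⟩ := expand_one_add (Zm a) (degreeOf_one_Zm a) δ n' η' hη'1
  obtain ⟨R', hR', hR'0, hR'1, hR'z⟩ :=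
    expand_T_add (Zm a) a δ δ (degreeOf_zero_Zm a) (degreeOf_one_Zm a) n' η' hη'0 hη'1
  rw [hsum'] at hR hR'
  let I : Type := S × Fin K
  obtain ⟨n, hn⟩ : ∃ n : ℕ, n = Fintype.card I := ⟨_, rfl⟩
  obtain ⟨e⟩ : Nonempty (I ≃ Fin n) := by rw [hn]; exact ⟨Fintype.equivFin I⟩
  let F : I → Poly2 := fun x => 1 + Zm N * (C (ζ ^ (x.2 : ℕ) * μ x.1) * Ls x.1)
  let F' : I → Poly2 := fun x => Zm N + C (ζ ^ (x.2 : ℕ) * μ x.1) * Ls x.1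
  let f : Fin n → Poly2 := fun j => F (e.symm j)
  let g : Fin n → Poly2 := fun _ => 1
  let f' : Fin n → Poly2 := fun j => F' (e.symm j)
  let g' : Fin n → Poly2 := fun _ => Zm N
  have hsq : ((-1 : Poly2) ^ (K + 1)) * (-1) ^ (K + 1) = 1 := by
    rw [← mul_pow]; simp
  have hblock : ∀ s : S, ∏ i : Fin K, F (s, i) = 1 + Zm a * η s := by
    intro s
    have h1 : ∀ i : Fin K, F (s, i) = 1 + C (ζ ^ (i : ℕ)) * (Zm N * (C (μ s) * Ls s)) := by
      intro i; show 1 + Zm N * (C (ζ ^ (i : ℕ) * μ s) * Ls s) = _; rw [map_mul]; ring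
    rw [Finset.prod_congr rfl (fun i _ => h1 i), prod_one_add_root_mul_fin hKpos hζ]
    rw [mul_pow, mul_pow, hZa, ← map_pow, hμ s, map_mul, map_pow, map_neg, map_one]
    show 1 + (-1) ^ (K + 1) * (Zm a * ((-1) ^ (K + 1) * C (cW s) * Ls s ^ K))
        = 1 + Zm a * (C (cW s) * Ls s ^ K)
    linear_combination (Zm a * C (cW s) * Ls s ^ K) * hsq
  have hblock' : ∀ s : S, ∏ i : Fin K, F' (s, i) = Zm a + η s := by
    intro s
    have h1 : ∀ i : Fin K, F' (s, i) = Zm N + C (ζ ^ (i : ℕ)) * (C (μ s) * Ls s) := by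
      intro i; show Zm N + C (ζ ^ (i : ℕ) * μ s) * Ls s = _; rw [map_mul]; ring
    rw [Finset.prod_congr rfl (fun i _ => h1 i), prod_T_add_root_mul_fin hKpos hζ]
    rw [mul_pow, hZa, ← map_pow, hμ s, map_mul, map_pow, map_neg, map_one]
    show Zm a + (-1) ^ (K + 1) * ((-1) ^ (K + 1) * C (cW s) * Ls s ^ K)
        = Zm a + C (cW s) * Ls s ^ K
    linear_combination (C (cW s) * Ls s ^ K) * hsq
  have hprodF : ∏ j, f j = 1 + Zm a * Q + Zm a ^ 2 * R := by
    have h1 : ∏ j, f j = ∏ x : I, F x :=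
      (Fintype.prod_equiv e.symm (fun j => f j) F fun j => rfl)
    rw [h1, Fintype.prod_prod_type, Finset.prod_congr rfl (fun s _ => hblock s), ← hR]
    exact Fintype.prod_equiv e' _ _ fun s => by simp [η']
  have hprodG : ∏ j, g j = (1 : Poly2) := by simp [g]
  have hprodF' : ∏ j, f' j = Zm a ^ n' + Zm a ^ (n' - 1) * Q + R' := by
    have h1 : ∏ j, f' j = ∏ x : I, F' x :=
      (Fintype.prod_equiv e.symm (fun j => f' j) F' fun j => rfl)
    rw [h1, Fintype.prod_prod_type, Finset.prod_congr rfl (fun s _ => hblock' s), ← hR']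
    exact Fintype.prod_equiv e' _ _ fun s => by simp [η']
  have hncard : n = n' * K := by
    rw [hn, hn', Fintype.card_prod, Fintype.card_fin]
  have hprodG' : ∏ j, g' j = Zm a ^ n' := by
    simp only [g', Finset.prod_const, Finset.card_univ, Fintype.card_fin]
    rw [hncard, show n' * K = K * n' from Nat.mul_comm _ _, pow_mul, hZa]
  have h2a : Zm a ^ 2 = Zm (2 * a) := by rw [Zm_pow, Nat.mul_comm]
  have hD : ∏ j, f j - ∏ j, g j = Zm a * Q + Zm (2 * a) * R := by
    rw [hprodF, hprodG, h2a]
    ring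
  obtain ⟨b, hb⟩ : ∃ b : ℕ, b = a * (n' - 1) := ⟨_, rfl⟩
  have hD' : ∏ j, f' j - ∏ j, g' j = Zm b * Q + R' := by
    rw [hprodF', hprodG', Zm_pow, Zm_pow, ← hb]
    ring
  have hRsupp : ∀ m ∈ (Zm (2 * a) * R).support, 2 * a ≤ m 0 ∧ m 1 ≤ (n' + 1) * δ := fun m hm =>
    ⟨x_ge_of_mem_support_Zm_mul hm, (y_le_of_mem_support_Zm_mul hm).trans hRdeg⟩
  have hR'supp : ∀ m ∈ R'.support, m 0 + ⌈N₀⌉₊ + 1 ≤ b ∧ m 1 ≤ n' * δ := by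
    intro m hm
    refine ⟨?_, (le_degreeOf_of_mem_support hm 1).trans hR'1⟩
    rcases Nat.lt_or_ge n' 2 with hsmall | hbig
    · exfalso
      rw [hR'z (by omega)] at hm
      simp at hm
    · have h1 : m 0 ≤ (n' - 2) * a + n' * δ := (le_degreeOf_of_mem_support hm 0).trans hR'0
      have hN' : n' * δ + ⌈N₀⌉₊ + 1 ≤ a := le_trans (by rw [hN]; omega) hNa
      obtain ⟨n'', hn''⟩ : ∃ n'', n' = n'' + 2 := ⟨n' - 2, by omega⟩
      rw [hb]
      rw [hn''] at h1 hN' ⊢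
      have e1 : n'' + 2 - 2 = n'' := by omega
      have e2 : n'' + 2 - 1 = n'' + 1 := by omega
      rw [e1] at h1
      rw [e2]
      have e3 : a * (n'' + 1) = n'' * a + a := by ring
      have e4 : (n'' + 2) * δ = n'' * δ + 2 * δ := by ring
      rw [e3]
      rw [e4] at h1 hN'
      omega
  have hQsupp : ∀ m ∈ (Zm a * Q).support, a ≤ m 0 ∧ m 0 ≤ a + δ := fun m hm =>
    ⟨x_ge_of_mem_support_Zm_mul hm,
      (x_le_of_mem_support_Zm_mul hm).trans (Nat.add_le_add_left hQ0deg a)⟩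
  have hQsupp' : ∀ m ∈ (Zm b * Q).support, b ≤ m 0 := fun m hm => x_ge_of_mem_support_Zm_mul hm
  have hδa : δ < a := by
    calc δ < N := by rw [hN]; omega
      _ ≤ a := hNa
  have hsuppD : (Zm a * Q + Zm (2 * a) * R).support
      = (Zm a * Q).support ∪ (Zm (2 * a) * R).support :=
    support_add_eq_of_disjoint fun m hm hm' => by
      have h1 := (hQsupp m hm).2; have h2 := (hRsupp m hm').1; omega
  have hsuppD' : (Zm b * Q + R').support = (Zm b * Q).support ∪ R'.support :=
    support_add_eq_of_disjoint fun m hm hm' => by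
      have h1 := hQsupp' m hm; have h2 := (hR'supp m hm').1; omega
  have hsetD : emb '' ((∏ j, f j - ∏ j, g j).support : Set _)
      = xsh (a : ℝ) '' (emb '' (Q.support : Set _))
        ∪ emb '' ((Zm (2 * a) * R).support : Set _) := by
    rw [hD, hsuppD, Finset.coe_union, Set.image_union, emb_image_support_Zm_mul]
  have hsetD' : emb '' ((∏ j, f' j - ∏ j, g' j).support : Set _)
      = xsh (b : ℝ) '' (emb '' (Q.support : Set _))
        ∪ emb '' (R'.support : Set _) := by
    rw [hD', hsuppD', Finset.coe_union, Set.image_union, emb_image_support_Zm_mul]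
  have hSRcond : ∀ r ∈ emb '' ((Zm (2 * a) * R).support : Set _),
      (a : ℝ) + N₀ ≤ r 0 ∧ 0 ≤ r 1 ∧ r 1 ≤ (Hn : ℝ) := by
    rintro _ ⟨m, hm, rfl⟩
    obtain ⟨h0, h1⟩ := hRsupp m hm
    refine ⟨?_, Nat.cast_nonneg _, castle (h1.trans hn1δH)⟩
    have e1 : ((2 * a : ℕ) : ℝ) ≤ ((m 0 : ℕ) : ℝ) := castle h0
    have e2 : ((N : ℕ) : ℝ) ≤ ((a : ℕ) : ℝ) := castle hNa
    push_cast at e1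
    show (a : ℝ) + N₀ ≤ ((m 0 : ℕ) : ℝ)
    linarith
  have hSR'cond : ∀ r ∈ emb '' (R'.support : Set _),
      r 0 + N₀ ≤ (b : ℝ) ∧ 0 ≤ r 1 ∧ r 1 ≤ (Hn : ℝ) := by
    rintro _ ⟨m, hm, rfl⟩
    obtain ⟨h0, h1⟩ := hR'supp m hm
    refine ⟨?_, Nat.cast_nonneg _, castle (h1.trans hnδH)⟩
    have e1 : ((m 0 + ⌈N₀⌉₊ + 1 : ℕ) : ℝ) ≤ ((b : ℕ) : ℝ) := castle h0
    push_cast at e1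
    have e3 := Nat.le_ceil N₀
    show ((m 0 : ℕ) : ℝ) + N₀ ≤ (b : ℝ)
    linarith
  have hmain := hcap (a : ℝ) (b : ℝ) _ _ (Set.toFinite _) (Set.toFinite _) hSRcond hSR'cond
  have hcardS : n' ≤ (k + 1) ^ 3 * (K + 1) ^ 4 := by
    rw [hn', Fintype.card_sigma]
    calc ∑ α : P.support, Fintype.card (DIdx (bexp K α.1))
        ≤ ∑ _α : P.support, (K + 1) ^ 4 :=
          Finset.sum_le_sum fun α _ => card_DIdx_le K α.1 (hdegα α.1 α.2)
      _ = P.support.card * (K + 1) ^ 4 := by simp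
      _ ≤ (k + 1) ^ 3 * (K + 1) ^ 4 :=
          Nat.mul_le_mul_right _ (card_support_le_of_totalDegree k P hP)
  have hnM : n ≤ Msize k := by
    rw [hncard, Msize]
    have h1 : k + 1 ≤ 3 * k + 3 := by omega
    have h2 : K + 1 ≤ 3 * k + 3 := by rw [hKdef]; omega
    have h3 : K ≤ 3 * k + 3 := by rw [hKdef]; omega
    calc n' * K ≤ (k + 1) ^ 3 * (K + 1) ^ 4 * K := Nat.mul_le_mul_right _ hcardS
      _ ≤ (3 * k + 3) ^ 3 * (3 * k + 3) ^ 4 * (3 * k + 3) := by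
          gcongr
      _ = (3 * k + 3) ^ 8 := by ring
  have hLs : ∀ s : S, (Ls s).support.card ≤ 3 * t + 1 := fun s => card_support_linForm_le w t hw _
  have hFsp : ∀ x : I, (F x).support.card ≤ 3 * t + 2 := fun x =>
    (card_support_add_le _ _).trans (by
      have h1 := card_support_one_le
      have h2 := (card_support_C_mul_le (ζ ^ (x.2 : ℕ) * μ x.1) (Ls x.1)).trans (hLs x.1)
      rw [card_support_Zm_mul]; omega)
  have hF'sp : ∀ x : I, (F' x).support.card ≤ 3 * t + 2 := fun x =>
    (card_support_add_le _ _).trans (by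
      have h1 := card_support_Zm_le N
      have h2 := (card_support_C_mul_le (ζ ^ (x.2 : ℕ) * μ x.1) (Ls x.1)).trans (hLs x.1)
      omega)
  refine ⟨n, f, g, f', g', hnM, fun j => hFsp _, fun j => ?_, fun j => hF'sp _, fun j => ?_, ?_⟩
  · exact card_support_one_le.trans (by omega)
  · exact (card_support_Zm_le N).trans (by omega)
  · rw [← hsetD, ← hsetD'] at hmain
    exact hmain

open Summit.ValiantsHypothesis.ValiantsHypothesis.Theses.NewtonUnitEquations (TwoProducts)

/-- **KERNEL, unconditional: `TwoProducts → RankThreeUniformT`** (★ typed transfer / refute-lens instrument,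
bookkeeping tier; NOT a cell, 0 distance; `TwoProducts`, `OLMLaw`, the rung: OPEN; VP ≠ VNP NOT proved). -/
theorem rankThreeUniformT_of_twoProducts (h : TwoProducts) : RankThreeUniformT :=
  uniformT_of_twoProducts Msize layerEmbedding_holds h

theorem olmUniformT_of_twoProducts' (h : TwoProducts) : OLMUniformT :=
  olmUniformT_of_twoProducts Msize layerEmbedding_holds h

/-- **KILL PATH (kernel): `¬RankThreeUniformT → ¬TwoProducts`** — any outer family `P_k` whose true
`t`-exponent is unbounded in `k` refutes the crux BY NAME.  No such family is known (every census reads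
exponent `1`). -/
theorem not_twoProducts_of_not_rankThreeUniformT (hneg : ¬ RankThreeUniformT) : ¬ TwoProducts :=
  not_twoProducts_of_not_uniformT Msize layerEmbedding_holds hneg

theorem not_twoProducts_of_not_olmUniformT' (hneg : ¬ OLMUniformT) : ¬ TwoProducts :=
  not_twoProducts_of_not_olmUniformT Msize layerEmbedding_holds hneg

end Assembly


/-! ## §T  The (TW-flag) currency (rev 2; director-valiant 11:44:09Z, crit-8 #114 (ii))

✓ p715618 (COL-4) `olm_nv_le_pow_of_twFlag` concludes literally the body of g11's Cruxes decl `OLMLaw` (its `nv` is the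
Theorems-side twin of g10's `nv`, definitionally equal).  Typed here once, so that the record shows `OLMUniformT` as the
COMMON consequence of `TwoProducts` (§S+F) and of «(TW-flag) with a polynomial `Q`»; `TWFlagBound` is a HYPOTHESIS SHAPE,
asserted by nobody; `OLMLaw` / `TwoProducts` remain OPEN; VP ≠ VNP is NOT proved. -/

section TWFlag

open Summit.ValiantsHypothesis.ValiantsHypothesis.Cruxes.TwoProducts.ValIdea35g10 (Poly2 nv OLMLaw)
open Summit.ValiantsHypothesis.ValiantsHypothesis.Theorems.TwoProducts.RankTwoJacobian (TWFlagBound olm_nv_le_pow_of_twFlag)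
open Summit.ValiantsHypothesis.ValiantsHypothesis.Theses.NewtonUnitEquations (TwoProducts)

/-- g10's `nv` and the Theorems-side `nv` of ✓ `RankTwoJacobian` are the same function, by `rfl`. -/
theorem nv_eq_theorems_nv (D : Poly2) :
    nv D = Summit.ValiantsHypothesis.ValiantsHypothesis.Theorems.TwoProducts.RankTwoJacobian.nv D := rfl

/-- **`OLMLaw ⟸ (TW-flag) with polynomial `Q`», in one line** (✓ p715618 `olm_nv_le_pow_of_twFlag`, typed against the
Cruxes decl `OLMLaw`; (TW-flag) is OPEN beyond single resonance lines). -/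
theorem olmLaw_of_twFlagPoly {Q : ℕ → ℕ → ℕ} (hQ : TWFlagBound Q) {a : ℕ}
    (hQa : ∀ K t, Q K t ≤ (K + 2) ^ a * (t + 2) ^ a) : OLMLaw :=
  olm_nv_le_pow_of_twFlag hQ hQa

theorem olmUniformT_of_twFlagPoly {Q : ℕ → ℕ → ℕ} (hQ : TWFlagBound Q) {a : ℕ}
    (hQa : ∀ K t, Q K t ≤ (K + 2) ^ a * (t + 2) ^ a) : OLMUniformT :=
  olmUniformT_of_olmLaw (olmLaw_of_twFlagPoly hQ hQa)

/-- **ONE CENSUS, TWO KILLS (kernel bookkeeping):** an OLM-slot family `P_m(x, y, u)` whose true `t`-exponent is unbounded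
in the degree `m` refutes BY NAME both the crux `TwoProducts` (via `layerEmbedding_holds`) and every polynomially bounded
`TWFlagBound Q` (via (COL-4)).  No such family is known; every census reads exponent `1`. -/
theorem twoKills_of_not_olmUniformT (hneg : ¬ OLMUniformT) :
    ¬ TwoProducts ∧ ∀ (Q : ℕ → ℕ → ℕ) (a : ℕ), (∀ K t, Q K t ≤ (K + 2) ^ a * (t + 2) ^ a) → ¬ TWFlagBound Q :=
  ⟨not_twoProducts_of_not_olmUniformT' hneg, fun _ _ hQa hQ => hneg (olmUniformT_of_twFlagPoly hQ hQa)⟩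

end TWFlag

end Summit.ValiantsHypothesis.ValiantsHypothesis.Cruxes.TwoProducts.ValIdea35g12
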